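import Literature.NumberTheory.Sieve.HeathBrownCubicWCalculus
import Literature.NumberTheory.Sieve.HeathBrownCubicUpperBoundWeights
import Literature.NumberTheory.LFunctions.DegreeOnePrimesPNT
import Mathlib.NumberTheory.AbelSummation
import HarnessLib

/-!
# Heath-Brown's Lemma 4.10: prime ideal tuples in a box, from the prime ideal theorem

Pure-proof file (no definitions) in the decomposition of **parity.S18**
(`Literature.NumberTheory.Sieve.setOf_prime_cube_add_two_mul_cube_infinite`) along D. R. Heath-Brown,
*Primes represented by `x³ + 2y³`*, Acta Math. 186 (2001), 1–84. **Lemma 4.10** (p. 27, "a corollary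
of the Prime Ideal Theorem") evaluates, for intervals `J_i = [a_i, ϱa_i)` (`a_i ≥ Δ`) and `Y`, the sum
`∑ ∏_{i≤m} log N(P_i)` over the tuples of prime ideals with `N(P_i) ∈ J_i` and `∏ N(P_i) ≤ Y` as
`meas(J(Y, m)) + O(mY(c₁ + log ϱ)^{m−1} exp{−c₂√(log Δ)})`, `J(Y, m) = {𝐱 : x_i ∈ J_i, ∏ x_i ≤ Y}`,
uniformly in `m`. It is the input of the `ℬ`-side of Lemma 3.9 (p. 64: "We now apply Lemma 4.10 … we
may take `ϱ = X^ξ` and `Δ = L`", for the boxes `∏ J(m_i)` of (3.12), where `meas(J(Y, m))` is the `w(Y, 𝐦)`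
of `HeathBrownCubicTypeII`) and of Lemma 3.8 (§9). This file PROVES it — `HeathBrown2001_lemma_4_10` —
for the first-degree prime ideals of `K = ℚ(2^{1/3})` (the ones that occur for `ℬ^(K)`, p. 17), by the
printed induction on `m` (pp. 27–28), from the degree-one prime number theorem with de la Vallée-Poussin
error term PROVED in the tree (`Literature.NumberTheory.LFunctions.NumberField.abs_degreeOneTheta_sub_self_le`,
resting on Landau's prime ideal theorem `…primeIdealTheorem_holds`), and specialises it to the boxes
`∏ J(m_i)` (`primeTuples_sub_wMeas_le`, in terms of `Jprimes` and `wMeas`).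

## The argument (pp. 27–28) and its rendering

* `m = 1` (`abs_windowSum_sub_meas_le`): `∑_{a ≤ N(P) < b, N(P) ≤ Y} log N(P) = θ₁(min(Y, b)) − θ₁(a) + O(log)`,
  `θ₁(x) = ∑_{p ≤ x} c_K(p) log p` (first-degree primes grouped by norm, `sum_firstDeg_eq_sum_primes`;
  the two prime sets differ at most in `p = a`, `p = b`, `abs_windowSum_sub_theta_le`), and
  `θ₁(x) = x + O(x exp(−c√(log x)))`; error `≤ (2C₀ + 32) Y exp(−c√(log a))`.
* the window sums with the SHARP constant (`sum_log_div_absNorm_le`):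
  `∑_{a ≤ N(P) < b} log N(P)/N(P) ≤ (1 + C₀ exp(−c√(log a))) log(b/a) + (8 + 2C₀)` by Abel summation with
  `f(t) = 1/t` (Mathlib's `sum_mul_eq_sub_sub_integral_mul`) — the printed "`≤ c₆ + log ϱ`"; the
  constant `1` in front of `log ϱ` is essential, since `(c₁ + log ϱ)^m` is later compared with
  `(log ϱ)^m = (ξ log X)^m` ((9.5)).
* the step `m → m + 1` (`lemma_4_10_aux`): split off the LAST prime (`sum_piFinset_eq_sum_snoc`), apply
  `m = 1` to it at the level `Y/∏_{i≤m} N(P_i)` — error (4.2)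
  `≤ C Y exp(…) ∏_i ∑_{P∈F_i} log N(P)/N(P) ≤ C Y exp(…)(c₁ + Λ)^m` (`Finset.prod_univ_sum`) —, write the
  main term `∑ ∏log N(P_i) · meas([a_{m+1}, b_{m+1}) ∩ [0, Y/∏N(P_i)])` as
  `∫_{J_{m+1}} [∑_{∏N(P_i) ≤ Y/t} ∏ log N(P_i)] dt` (`integral_finsetSum`, `integral_Ico_ite_le_const`),
  apply the induction hypothesis inside the integral — error (4.3),
  `∫_{J_{m+1}} C m (Y/t)(c₁+Λ)^{m−1} exp(…) dt = C m Y (c₁+Λ)^{m−1} exp(…) log(b/a)` — and Fubini,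
  `∫_{J_{m+1}} meas(J(Y/t, m)) dt = meas(J(Y, m+1))` (`toReal_volume_boxLE_eq_integral_last`, Tonelli on
  the last coordinate with the OUTER integral over it, `lintegral_box_eq_lintegral_last`); the constants
  bookkeeping "`c₃ ≥ c₅`, `c₁ ≥ c₆`, `c₂ ≤ c₄`" is `C = c₅ = 2C₀ + 32`, `c₁ = c₆ = 8 + 2C₀ + 4C₀/c²`.

Rendering (all PROVED, so these are choices, not weakenings of a vendored statement): tuples are
ordered tuples of first-degree prime ideals (`(N(P)).Prime`), given through finsets `F_i` characterised
by membership (so that `Jprimes X τ (m i)` qualifies via `mem_Jprimes_iff`); intervals `[lo_i, hi_i)`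
with `log(hi_i/lo_i) ≤ Λ` in place of a common ratio `ϱ`; `Δ ≥ 3`; `Y > 0`; and the hypothesis
`Λ ≤ log Δ` (`ϱ ≤ Δ`), implicit in the printed proof (it is what makes `log ϱ · exp(−c√(log Δ)) = O(1)` in
"`≤ c₆ + log ϱ`") and satisfied in both applications (`ϱ = X^ξ`, `Δ ≥ X^τ`, `ξ = τ⁵ ≤ τ`).

## References

* D. R. Heath-Brown, *Primes represented by `x³ + 2y³`*, Acta Math. 186 (2001), 1–84: Lemma 4.10 and
  its proof, pp. 27–28 ((4.2), (4.3)); its use on p. 64. [cite: HeathBrownActa2001, Lemma 4.10]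

## Mathlib / tree search

Tree: `LFunctions/DegreeOnePrimesPNT` (`degreeOneTheta`, `abs_degreeOneTheta_sub_self_le`,
`degreeOneTheta_nonneg`, `ThetaMertens.measurable_thetaWeight`, the Abel-summation pattern of
`sum_primesLE_div_of_theta`), `LFunctions/IdealNormCount` (`idealNormCount`, `idealNormCount_prime_le`),
`LFunctions/CubeRootTwoField` (`finrank_K`), `Nat.primesLE_eq_filter_Icc_zero`,
`Sieve/HeathBrownCubicWCalculus` (`lintegral_box_eq_lintegral_snoc`, `volume_restrict_box`,
`toReal_volume_boxLE_eq_integral`, `volume_Ico_inter_le`, `volume_box_lt_top`, `measurableSet_prod_le`,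
`log_hbBox_ratio`), `Sieve/HeathBrownCubicTypeII` (`Jprimes`, `mem_Jprimes_iff`, `wMeas`, `hbXi_le`,
`CoreAdmissible`), `Sieve/HeathBrownCubicSieveSetup` (`primesNormIco`). Mathlib:
`sum_mul_eq_sub_sub_integral_mul` (Abel), `deriv_inv'`, `integral_inv_of_pos`,
`Finset.filter_piFinset_eq_map_snocEquiv`, `Fintype.piFinset_of_isEmpty`, `Finset.prod_univ_sum`,
`Fin.prod_univ_castSucc`, `Measure.pi_of_empty`, `integral_dirac`, `lintegral_prod`,
`measurePreserving_piFinSuccAbove`, `Monotone.measurable`, `ofReal_integral_eq_lintegral_ofReal`,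
`integral_finsetSum`, `Ideal.isPrime_of_irreducible_absNorm`, `Nat.ceil_le`, `Nat.lt_ceil`,
`Nat.floor_lt`, `Nat.le_floor_iff`, `Real.log_le_rpow_div`, `Real.add_one_le_exp`.
-/

noncomputable section

open MeasureTheory Set Filter Topology Finset NumberField
open scoped ENNReal

namespace Literature.NumberTheory.Sieve.CubicSieve

open LFunctions.CubeRootTwoField
open Literature.NumberTheory.LFunctions (idealNormCount idealNormCount_def idealNormCount_prime_le)
open Literature.NumberTheory.LFunctions.NumberField (degreeOneTheta abs_degreeOneTheta_sub_self_le)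

/-! ### More on the general box: Tonelli in the other order, the case of one coordinate, monotonicity -/

section GeneralBox

variable {j : ℕ}

/-- **Tonelli on the last coordinate of a box, outer integral over the last coordinate**: for
measurable `F ≥ 0`, `∫_{∏_{i≤j}[a_i,b_i)} F = ∫_{[a_j,b_j)} ∫_{∏_{i<j}[a_i,b_i)} F(x', y) dx' dy` (the order of
"`∫_{J_{m+1}} meas(J(Y/t, m)) dt = meas(J(Y, m+1))`", p. 28). [folklore] -/
theorem lintegral_box_eq_lintegral_last (a b : Fin (j + 1) → ℝ) {F : (Fin (j + 1) → ℝ) → ℝ≥0∞}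
    (hF : Measurable F) :
    ∫⁻ x in Set.univ.pi fun i => Ico (a i) (b i), F x =
      ∫⁻ y in Ico (a (Fin.last j)) (b (Fin.last j)),
        ∫⁻ x' in Set.univ.pi fun i : Fin j => Ico (a (Fin.castSucc i)) (b (Fin.castSucc i)),
          F (Fin.snoc x' y) := by
  set μ : Fin (j + 1) → Measure ℝ := fun i => (volume : Measure ℝ).restrict (Ico (a i) (b i)) with hμ
  set e := MeasurableEquiv.piFinSuccAbove (fun _ : Fin (j + 1) => ℝ) (Fin.last j) with he_def
  have he : MeasurePreserving e (Measure.pi μ)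
      ((μ (Fin.last j)).prod (Measure.pi fun i => μ ((Fin.last j).succAbove i))) :=
    measurePreserving_piFinSuccAbove μ (Fin.last j)
  rw [volume_restrict_box, volume_restrict_box]
  have hFe : Measurable fun p : ℝ × (Fin j → ℝ) => F (e.symm p) := hF.comp e.symm.measurable
  rw [← he.symm.lintegral_comp_emb e.symm.measurableEmbedding, lintegral_prod _ hFe.aemeasurable]
  simp only [he_def, MeasurableEquiv.piFinSuccAbove_symm_apply, hμ, Fin.succAbove_last]
  refine lintegral_congr fun y => lintegral_congr fun x' => ?_
  change F (Fin.insertNth (Fin.last j) y x') = F (Fin.snoc x' y)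
  rw [Fin.insertNth_last']

/-- **Fubini for `w`, outer integral over the last coordinate** (p. 28: "`∫_{J_{m+1}} meas(J(Y/t, m)) dt
= meas(J(Y, m+1))`"): `meas{x ∈ ∏_{i≤j}[a_i,b_i) : ∏x ≤ Y} = ∫_{[a_j,b_j)} meas{x' ∈ ∏_{i<j}[a_i,b_i) : ∏x' ≤ Y/y} dy`
(`a_i > 0`), Lebesgue form. [cite: HeathBrownActa2001, Lemma 4.10] -/
theorem volume_boxLE_eq_lintegral_last (a b : Fin (j + 1) → ℝ) (ha : ∀ i, 0 < a i) (Y : ℝ) :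
    volume {x : Fin (j + 1) → ℝ | (∀ i, x i ∈ Ico (a i) (b i)) ∧ ∏ i, x i ≤ Y} =
      ∫⁻ y in Ico (a (Fin.last j)) (b (Fin.last j)),
        volume {x' : Fin j → ℝ | (∀ i, x' i ∈ Ico (a (Fin.castSucc i)) (b (Fin.castSucc i))) ∧
          ∏ i, x' i ≤ Y / y} := by
  have hS : {x : Fin (j + 1) → ℝ | (∀ i, x i ∈ Ico (a i) (b i)) ∧ ∏ i, x i ≤ Y} =
      {x | ∏ i, x i ≤ Y} ∩ Set.univ.pi fun i => Ico (a i) (b i) := by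
    ext x
    simp only [mem_setOf_eq, mem_inter_iff, mem_univ_pi]
    exact and_comm
  have hmeas := measurableSet_prod_le (j + 1) Y
  rw [hS, ← Measure.restrict_apply hmeas, ← lintegral_indicator_one hmeas,
    lintegral_box_eq_lintegral_last a b (measurable_one.indicator hmeas)]
  refine setLIntegral_congr_fun measurableSet_Ico fun y hy => ?_
  have hy0 : 0 < y := (ha _).trans_le hy.1
  have hS' : {x' : Fin j → ℝ | (∀ i, x' i ∈ Ico (a (Fin.castSucc i)) (b (Fin.castSucc i))) ∧
      ∏ i, x' i ≤ Y / y} =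
      {x' | ∏ i, x' i ≤ Y / y} ∩ Set.univ.pi fun i : Fin j => Ico (a (Fin.castSucc i)) (b (Fin.castSucc i)) := by
    ext x
    simp only [mem_setOf_eq, mem_inter_iff, mem_univ_pi]
    exact and_comm
  have hmeas' := measurableSet_prod_le j (Y / y)
  rw [hS', ← Measure.restrict_apply hmeas', ← lintegral_indicator_one hmeas']
  refine lintegral_congr fun x' => ?_
  simp only [Set.indicator, mem_setOf_eq, Fin.prod_snoc, Pi.one_apply, le_div_iff₀ hy0]

/-- `meas{x ∈ box : ∏ x ≤ Y}` is monotone in `Y`. [folklore] -/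
theorem volume_boxLE_mono (a b : Fin j → ℝ) {Y Y' : ℝ} (h : Y ≤ Y') :
    volume {x : Fin j → ℝ | (∀ i, x i ∈ Ico (a i) (b i)) ∧ ∏ i, x i ≤ Y} ≤
      volume {x : Fin j → ℝ | (∀ i, x i ∈ Ico (a i) (b i)) ∧ ∏ i, x i ≤ Y'} :=
  measure_mono fun _ hx => ⟨hx.1, hx.2.trans h⟩

/-- `meas{x ∈ box : ∏ x ≤ Y} ≤ meas(box)` (`< ∞`). [folklore] -/
theorem volume_boxLE_le_volume_box (a b : Fin j → ℝ) (Y : ℝ) :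
    volume {x : Fin j → ℝ | (∀ i, x i ∈ Ico (a i) (b i)) ∧ ∏ i, x i ≤ Y} ≤
      volume (Set.univ.pi fun i : Fin j => Ico (a i) (b i)) :=
  measure_mono fun _ hx => Set.mem_univ_pi.mpr hx.1

/-- The real-valued `Y ↦ meas{x ∈ box : ∏ x ≤ Y}` is monotone (hence measurable). [folklore] -/
theorem monotone_toReal_volume_boxLE (a b : Fin j → ℝ) :
    Monotone fun Y : ℝ =>
      (volume {x : Fin j → ℝ | (∀ i, x i ∈ Ico (a i) (b i)) ∧ ∏ i, x i ≤ Y}).toReal :=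
  fun _ _ h => ENNReal.toReal_mono
    ((volume_boxLE_le_volume_box a b _).trans_lt (volume_box_lt_top a b)).ne (volume_boxLE_mono a b h)

/-- **The case of one coordinate**: `meas{x ∈ [lo, hi) : x ≤ Y} = (min Y hi − lo)⁺` (a box in `ℝ^1`,
`lo > 0`; the main term of Lemma 4.10 for `m = 1`). [cite: HeathBrownActa2001, Lemma 4.10] -/
theorem toReal_volume_boxLE_one (a b : Fin 1 → ℝ) (ha : 0 < a 0) (Y : ℝ) :
    (volume {x : Fin 1 → ℝ | (∀ i, x i ∈ Ico (a i) (b i)) ∧ ∏ i, x i ≤ Y}).toReal =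
      max 0 (min Y (b 0) - a 0) := by
  rw [toReal_volume_boxLE_eq_integral a b (fun i => by fin_cases i; exact ha) Y]
  have hvol : (volume : Measure (Fin 0 → ℝ)).restrict
      (Set.univ.pi fun i : Fin 0 => Ico (a (Fin.castSucc i)) (b (Fin.castSucc i))) =
      Measure.dirac (fun _ => 0) := by
    rw [volume_restrict_box, Measure.pi_of_empty _ (fun _ => 0)]
  rw [hvol, integral_dirac]
  simp only [Finset.univ_eq_empty, Finset.prod_empty, div_one]
  rfl

/-- **Fubini for `w`, real form, outer integral over the last coordinate** (p. 28):
`meas{x ∈ ∏_{i≤j}[a_i,b_i) : ∏x ≤ Y} = ∫_{[a_j,b_j)} meas{x' : ∏x' ≤ Y/y} dy` (`a_i > 0`; the integrand is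
monotone in `Y/y`, hence measurable, and bounded by `meas(box')`). [cite: HeathBrownActa2001, Lemma 4.10] -/
theorem toReal_volume_boxLE_eq_integral_last (a b : Fin (j + 1) → ℝ) (ha : ∀ i, 0 < a i) (Y : ℝ) :
    (volume {x : Fin (j + 1) → ℝ | (∀ i, x i ∈ Ico (a i) (b i)) ∧ ∏ i, x i ≤ Y}).toReal =
      ∫ y in Ico (a (Fin.last j)) (b (Fin.last j)),
        (volume {x' : Fin j → ℝ | (∀ i, x' i ∈ Ico (a (Fin.castSucc i)) (b (Fin.castSucc i))) ∧
          ∏ i, x' i ≤ Y / y}).toReal := by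
  set W : ℝ → ℝ := fun Z => (volume {x' : Fin j → ℝ |
    (∀ i, x' i ∈ Ico (a (Fin.castSucc i)) (b (Fin.castSucc i))) ∧ ∏ i, x' i ≤ Z}).toReal with hW
  have hWmono : Monotone W := monotone_toReal_volume_boxLE _ _
  have hfin : ∀ Z, volume {x' : Fin j → ℝ |
      (∀ i, x' i ∈ Ico (a (Fin.castSucc i)) (b (Fin.castSucc i))) ∧ ∏ i, x' i ≤ Z} ≠ ⊤ := fun Z =>
    ((volume_boxLE_le_volume_box _ _ _).trans_lt (volume_box_lt_top _ _)).ne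
  have hmeas : Measurable fun y : ℝ => W (Y / y) :=
    hWmono.measurable.comp (measurable_const.div measurable_id)
  rw [volume_boxLE_eq_lintegral_last a b ha Y]
  have hcongr : ∀ y, volume {x' : Fin j → ℝ |
      (∀ i, x' i ∈ Ico (a (Fin.castSucc i)) (b (Fin.castSucc i))) ∧ ∏ i, x' i ≤ Y / y} =
      ENNReal.ofReal (W (Y / y)) := fun y => by
    rw [hW, ENNReal.ofReal_toReal (hfin _)]
  simp_rw [hcongr]
  rw [← ofReal_integral_eq_lintegral_ofReal]
  · rw [ENNReal.toReal_ofReal (setIntegral_nonneg measurableSet_Ico fun y _ => ENNReal.toReal_nonneg)]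
    refine setIntegral_congr_fun measurableSet_Ico fun y _ => ?_
    rw [ENNReal.toReal_ofReal ENNReal.toReal_nonneg]
  · haveI : IsFiniteMeasure ((volume : Measure ℝ).restrict (Ico (a (Fin.last j)) (b (Fin.last j)))) :=
      ⟨by rw [Measure.restrict_apply_univ, Real.volume_Ico]; exact ENNReal.ofReal_lt_top⟩
    refine Integrable.mono' (integrable_const (volume (Set.univ.pi fun i : Fin j =>
      Ico (a (Fin.castSucc i)) (b (Fin.castSucc i)))).toReal) hmeas.aestronglyMeasurable
      (Eventually.of_forall fun y => ?_)
    rw [Real.norm_eq_abs, abs_of_nonneg ENNReal.toReal_nonneg]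
    exact ENNReal.toReal_mono (volume_box_lt_top _ _).ne (volume_boxLE_le_volume_box _ _ _)
  · exact Eventually.of_forall fun y => ENNReal.toReal_nonneg

end GeneralBox

/-! ### First-degree prime ideals in a norm window and the weights `c_K(p)` -/

section PrimeSums

/-- `c_K(p) ≤ 8` for the cubic field `K = ℚ(2^{1/3})` (`c_K(p) ≤ 2^{[K:ℚ]}`,
`Literature.NumberTheory.LFunctions.idealNormCount_prime_le`, and `[K:ℚ] = 3`). [folklore] -/
theorem idealNormCount_le_eight {p : ℕ} (hp : p.Prime) : (idealNormCount K p : ℝ) ≤ 8 := by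
  have h := idealNormCount_prime_le K hp
  rw [finrank_K] at h
  norm_num at h
  exact_mod_cast h

/-- An ideal of prime norm is a nonzero prime ideal. [folklore] -/
theorem isPrime_and_ne_bot_of_prime_absNorm {I : Ideal (𝓞 K)} (h : (Ideal.absNorm I).Prime) :
    I.IsPrime ∧ I ≠ ⊥ :=
  ⟨Ideal.isPrime_of_irreducible_absNorm h, fun h0 => by
    rw [h0, Ideal.absNorm_bot] at h; exact Nat.not_prime_zero h⟩

/-- **Grouping first-degree prime ideals by their norm**: if `F` is the set of prime ideals `P` with
`lo ≤ N(P) < hi` and `N(P)` a rational prime (the first-degree prime ideals of the window), then for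
every `g`, `∑_{P ∈ F} g(N(P)) = ∑_{p prime, lo ≤ p < hi} c_K(p) g(p)`, `c_K(p) = #{I : N(I) = p}`
(`Literature.NumberTheory.LFunctions.idealNormCount`). [folklore] -/
theorem sum_firstDeg_eq_sum_primes {F : Finset (Ideal (𝓞 K))} {lo hi : ℝ}
    (hF : ∀ P, P ∈ F ↔ P.IsPrime ∧ P ≠ ⊥ ∧ lo ≤ (Ideal.absNorm P : ℝ) ∧
      (Ideal.absNorm P : ℝ) < hi ∧ (Ideal.absNorm P).Prime) (g : ℕ → ℝ) :
    ∑ P ∈ F, g (Ideal.absNorm P) =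
      ∑ p ∈ (Finset.Ico ⌈lo⌉₊ ⌈hi⌉₊).filter Nat.Prime, (idealNormCount K p : ℝ) * g p := by
  classical
  have hmaps : ∀ P ∈ F, Ideal.absNorm P ∈ (Finset.Ico ⌈lo⌉₊ ⌈hi⌉₊).filter Nat.Prime := by
    intro P hP
    obtain ⟨-, -, h1, h2, h3⟩ := (hF P).mp hP
    rw [mem_filter, Finset.mem_Ico]
    exact ⟨⟨Nat.ceil_le.mpr h1, Nat.lt_ceil.mpr h2⟩, h3⟩
  rw [← sum_fiberwise_of_maps_to hmaps]
  refine sum_congr rfl fun p hp => ?_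
  rw [mem_filter, Finset.mem_Ico] at hp
  rw [sum_congr rfl (fun P hP => by rw [(mem_filter.mp hP).2] :
      ∀ P ∈ F.filter (fun P => Ideal.absNorm P = p), g (Ideal.absNorm P) = g p),
    sum_const, nsmul_eq_mul]
  congr 1
  rw [idealNormCount_def, ← Nat.card_eq_finsetCard]
  congr 1
  refine Nat.card_congr (Equiv.subtypeEquivRight fun P => ?_)
  simp only [mem_filter]
  constructor
  · exact fun h => h.2
  · intro h
    refine ⟨(hF P).mpr ⟨?_, ?_, ?_, ?_, ?_⟩, h⟩
    · exact (isPrime_and_ne_bot_of_prime_absNorm (h ▸ hp.2)).1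
    · exact (isPrime_and_ne_bot_of_prime_absNorm (h ▸ hp.2)).2
    · rw [h]; exact Nat.ceil_le.mp hp.1.1
    · rw [h]; exact Nat.lt_ceil.mp hp.1.2
    · rw [h]; exact hp.2

/-- `θ₁(u) − θ₁(v) = ∑_{v < p ≤ u} c_K(p) log p` for `v ≤ u`, where `θ₁(x) = ∑_{p ≤ x} c_K(p) log p` is
the degree-one Chebyshev function `Literature.NumberTheory.LFunctions.NumberField.degreeOneTheta`. [folklore] -/
theorem degreeOneTheta_sub_eq {v u : ℝ} (hvu : v ≤ u) :
    degreeOneTheta K u - degreeOneTheta K v =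
      ∑ p ∈ (Finset.Ioc ⌊v⌋₊ ⌊u⌋₊).filter Nat.Prime, (idealNormCount K p : ℝ) * Real.log p := by
  unfold degreeOneTheta
  rw [Nat.primesLE_eq_filter_range, Nat.primesLE_eq_filter_range, sum_filter, sum_filter, sum_filter,
    Finset.range_eq_Ico, Finset.range_eq_Ico]
  have hle : ⌊v⌋₊ + 1 ≤ ⌊u⌋₊ + 1 := Nat.succ_le_succ (Nat.floor_le_floor hvu)
  rw [← Finset.sum_Ico_consecutive _ (Nat.zero_le _) hle, add_sub_cancel_left,
    Finset.Ico_add_one_add_one_eq_Ioc]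

variable {c C₀ : ℝ}

/-- `exp(c√(log u)) ≤ e^{1/2} √u` for `c ≤ 1`, `u ≥ 1` (as `c√v ≤ (1 + v)/2`). [folklore] -/
theorem exp_mul_sqrt_log_le (hc : c ≤ 1) {u : ℝ} (hu : 1 ≤ u) :
    Real.exp (c * Real.sqrt (Real.log u)) ≤ Real.exp (1 / 2) * Real.sqrt u := by
  have hl : 0 ≤ Real.log u := Real.log_nonneg hu
  have hs : 0 ≤ Real.sqrt (Real.log u) := Real.sqrt_nonneg _
  have h1 : c * Real.sqrt (Real.log u) ≤ (1 + Real.log u) / 2 := by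
    have hsq := Real.sq_sqrt hl
    nlinarith [sq_nonneg (Real.sqrt (Real.log u) - 1)]
  calc Real.exp (c * Real.sqrt (Real.log u)) ≤ Real.exp ((1 + Real.log u) / 2) := Real.exp_le_exp.mpr h1
    _ = Real.exp (1 / 2) * Real.sqrt u := by
        rw [add_div, Real.exp_add, Real.sqrt_eq_rpow, Real.rpow_def_of_pos (by linarith)]
        ring_nf

/-- `log u ≤ 4 u exp(−c√(log u))` for `u ≥ 1`, `c ≤ 1` — a single prime's `log p` is negligible
against the de la Vallée-Poussin error. [folklore] -/
theorem log_le_mul_exp_neg (hc : c ≤ 1) {u : ℝ} (hu : 1 ≤ u) :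
    Real.log u ≤ 4 * u * Real.exp (-(c * Real.sqrt (Real.log u))) := by
  have hu0 : 0 < u := by linarith
  have hsu : 0 < Real.sqrt u := Real.sqrt_pos.mpr hu0
  have h1 : Real.log u ≤ 2 * Real.sqrt u := by
    have := Real.log_le_rpow_div hu0.le (by norm_num : (0 : ℝ) < 1 / 2)
    rw [← Real.sqrt_eq_rpow] at this
    linarith
  have h2 := exp_mul_sqrt_log_le hc hu
  have he : Real.exp (1 / 2) ≤ 2 := by
    have h1 := Real.exp_one_lt_d9
    have hsq : Real.exp (1 / 2) ^ 2 = Real.exp 1 := by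
      rw [← Real.exp_nat_mul]; norm_num
    nlinarith [Real.exp_pos (1 / 2)]
  have hl0 : 0 ≤ Real.log u := Real.log_nonneg hu
  rw [Real.exp_neg, le_mul_inv_iff₀ (Real.exp_pos _)]
  calc Real.log u * Real.exp (c * Real.sqrt (Real.log u))
      ≤ 2 * Real.sqrt u * (Real.exp (1 / 2) * Real.sqrt u) :=
        mul_le_mul h1 h2 (Real.exp_pos _).le (by positivity)
    _ = 2 * Real.exp (1 / 2) * u := by
        rw [mul_mul_mul_comm, Real.mul_self_sqrt hu0.le]
    _ ≤ 4 * u := by nlinarith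

/-- The weight `[p prime] c_K(p) log p` is nonnegative. [folklore] -/
theorem primeWt_nonneg (p : ℕ) : 0 ≤ (if p.Prime then (idealNormCount K p : ℝ) * Real.log p else 0) := by
  split_ifs with hp
  · exact mul_nonneg (Nat.cast_nonneg _) (Real.log_nonneg (by exact_mod_cast hp.one_lt.le))
  · exact le_rfl

/-- The weight `c_K(p) log p` of at most one prime `p = n ≤ x` (`n ≥ 1`) is at most `8 log x`. [folklore] -/
theorem sum_filter_singleton_primeWt_le {n : ℕ} {x : ℝ} (hn : (n : ℝ) ≤ x) (hn1 : 1 ≤ n) :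
    ∑ p ∈ ({n} : Finset ℕ).filter Nat.Prime, (idealNormCount K p : ℝ) * Real.log p ≤ 8 * Real.log x := by
  have hlx : 0 ≤ Real.log x := Real.log_nonneg ((by exact_mod_cast hn1 : (1 : ℝ) ≤ n).trans hn)
  rw [sum_filter, sum_singleton]
  split_ifs with hp
  · have h1 : Real.log n ≤ Real.log x := Real.log_le_log (by exact_mod_cast hn1) hn
    have h2 : 0 ≤ Real.log (n : ℝ) := Real.log_nonneg (by exact_mod_cast hn1)
    calc (idealNormCount K n : ℝ) * Real.log n ≤ 8 * Real.log n :=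
          mul_le_mul_of_nonneg_right (idealNormCount_le_eight hp) h2
      _ ≤ 8 * Real.log x := by linarith
  · linarith

/-- `∑_{s ∪ t} f ≤ ∑_s f + ∑_t f` when `f ≥ 0` on `s ∩ t`. [folklore] -/
theorem sum_union_le_of_nonneg {ι : Type*} [DecidableEq ι] {s t : Finset ι} {f : ι → ℝ}
    (hf : ∀ i ∈ s ∩ t, 0 ≤ f i) : ∑ i ∈ s ∪ t, f i ≤ ∑ i ∈ s, f i + ∑ i ∈ t, f i := by
  have := sum_union_inter (s₁ := s) (s₂ := t) (f := f)
  linarith [sum_nonneg hf]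

/-- **The window prime sum against `θ₁`**: for `3 ≤ lo ≤ hi`, `lo ≤ Y` and `u = min Y hi`,
`|∑_{P ∈ F, N(P) ≤ Y} log N(P) − (θ₁(u) − θ₁(lo))| ≤ 8 log u` (the two prime sets differ at most in
`p = lo` and `p = hi`, each of weight `≤ 8 log u`). [folklore] -/
theorem abs_windowSum_sub_theta_le {F : Finset (Ideal (𝓞 K))} {lo hi : ℝ}
    (hF : ∀ P, P ∈ F ↔ P.IsPrime ∧ P ≠ ⊥ ∧ lo ≤ (Ideal.absNorm P : ℝ) ∧
      (Ideal.absNorm P : ℝ) < hi ∧ (Ideal.absNorm P).Prime)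
    (hlo : 3 ≤ lo) (hlohi : lo ≤ hi) {Y : ℝ} (hY : lo ≤ Y) :
    |(∑ P ∈ F, if (Ideal.absNorm P : ℝ) ≤ Y then Real.log (Ideal.absNorm P) else 0) -
        (degreeOneTheta K (min Y hi) - degreeOneTheta K lo)| ≤ 8 * Real.log (min Y hi) := by
  classical
  set u := min Y hi with hu
  have hlou : lo ≤ u := le_min hY hlohi
  have hlo0 : 0 ≤ lo := by linarith
  have hu0 : 0 ≤ u := hlo0.trans hlou
  set w : ℕ → ℝ := fun p => (idealNormCount K p : ℝ) * Real.log p with hw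
  set A := ((Finset.Ico ⌈lo⌉₊ ⌈hi⌉₊).filter Nat.Prime).filter (fun p : ℕ => (p : ℝ) ≤ Y) with hA
  set B := (Finset.Ioc ⌊lo⌋₊ ⌊u⌋₊).filter Nat.Prime with hB
  have hSA : (∑ P ∈ F, if (Ideal.absNorm P : ℝ) ≤ Y then Real.log (Ideal.absNorm P) else 0) =
      ∑ p ∈ A, w p := by
    rw [sum_firstDeg_eq_sum_primes hF (fun n : ℕ => if (n : ℝ) ≤ Y then Real.log n else 0), hA,
      Finset.sum_filter (fun p : ℕ => (p : ℝ) ≤ Y)]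
    refine sum_congr rfl fun p _ => ?_
    split_ifs <;> simp [hw]
  have hSB : degreeOneTheta K u - degreeOneTheta K lo = ∑ p ∈ B, w p := degreeOneTheta_sub_eq hlou
  have hwnn : ∀ p, p.Prime → 0 ≤ w p := fun p hp =>
    mul_nonneg (Nat.cast_nonneg _) (Real.log_nonneg (by exact_mod_cast hp.one_lt.le))
  have hprimeA : ∀ p ∈ A, p.Prime := fun p hp => (mem_filter.mp (mem_filter.mp hp).1).2
  have hprimeB : ∀ p ∈ B, p.Prime := fun p hp => (mem_filter.mp hp).2
  have hprimeS : ∀ (n : ℕ), ∀ p ∈ ({n} : Finset ℕ).filter Nat.Prime, p.Prime :=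
    fun n p hp => (mem_filter.mp hp).2
  -- `A ⊆ B ∪ {⌊lo⌋ if prime}` and `B ⊆ A ∪ {⌊u⌋ if prime}`
  have hAB : A ⊆ B ∪ ({⌊lo⌋₊} : Finset ℕ).filter Nat.Prime := by
    intro p hp
    have hp' := hp
    rw [hA, mem_filter, mem_filter, Finset.mem_Ico] at hp'
    obtain ⟨⟨⟨h1, h2⟩, hpp⟩, hpY⟩ := hp'
    have hlop : lo ≤ p := Nat.ceil_le.mp h1
    have hphi : (p : ℝ) < hi := Nat.lt_ceil.mp h2
    have hpu : p ≤ ⌊u⌋₊ := Nat.le_floor (le_min hpY hphi.le)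
    rcases hlop.lt_or_eq with hlt | heq
    · exact mem_union_left _ (mem_filter.mpr ⟨Finset.mem_Ioc.mpr ⟨(Nat.floor_lt hlo0).mpr hlt, hpu⟩, hpp⟩)
    · refine mem_union_right _ (mem_filter.mpr ⟨mem_singleton.mpr ?_, hpp⟩)
      rw [heq, Nat.floor_natCast]
  have hBA : B ⊆ A ∪ ({⌊u⌋₊} : Finset ℕ).filter Nat.Prime := by
    intro p hp
    have hp' := hp
    rw [hB, mem_filter, Finset.mem_Ioc] at hp'
    obtain ⟨⟨h1, h2⟩, hpp⟩ := hp'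
    have hlop : lo < p := (Nat.floor_lt hlo0).mp h1
    have hpu : (p : ℝ) ≤ u := (Nat.le_floor_iff hu0).mp h2
    have hpY : (p : ℝ) ≤ Y := hpu.trans (min_le_left _ _)
    have hphi : (p : ℝ) ≤ hi := hpu.trans (min_le_right _ _)
    rcases hphi.lt_or_eq with hlt | heq
    · refine mem_union_left _ (mem_filter.mpr ⟨mem_filter.mpr ⟨Finset.mem_Ico.mpr ⟨?_, ?_⟩, hpp⟩, hpY⟩)
      · exact Nat.ceil_le.mpr hlop.le
      · exact Nat.lt_ceil.mpr hlt
    · refine mem_union_right _ (mem_filter.mpr ⟨mem_singleton.mpr ?_, hpp⟩)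
      have hueq : u = p := le_antisymm (heq ▸ min_le_right _ _) hpu
      rw [hueq, Nat.floor_natCast]
  have h3lo : (3 : ℝ) ≤ ⌊lo⌋₊ := by
    have : (3 : ℕ) ≤ ⌊lo⌋₊ := Nat.le_floor (by exact_mod_cast hlo)
    exact_mod_cast this
  have hsumA : ∑ p ∈ A, w p ≤ ∑ p ∈ B, w p + 8 * Real.log u := by
    calc ∑ p ∈ A, w p ≤ ∑ p ∈ B ∪ ({⌊lo⌋₊} : Finset ℕ).filter Nat.Prime, w p :=
          sum_le_sum_of_subset_of_nonneg hAB fun p hp _ => hwnn p (by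
            rcases mem_union.mp hp with h | h
            · exact hprimeB p h
            · exact hprimeS _ p h)
      _ ≤ ∑ p ∈ B, w p + ∑ p ∈ ({⌊lo⌋₊} : Finset ℕ).filter Nat.Prime, w p :=
          sum_union_le_of_nonneg fun p hp => hwnn p (hprimeB p (mem_inter.mp hp).1)
      _ ≤ ∑ p ∈ B, w p + 8 * Real.log u := by
          have := sum_filter_singleton_primeWt_le (x := u) (n := ⌊lo⌋₊)
            ((Nat.floor_le hlo0).trans hlou) (Nat.le_floor (by norm_num; linarith))
          linarith
  have hsumB : ∑ p ∈ B, w p ≤ ∑ p ∈ A, w p + 8 * Real.log u := by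
    calc ∑ p ∈ B, w p ≤ ∑ p ∈ A ∪ ({⌊u⌋₊} : Finset ℕ).filter Nat.Prime, w p :=
          sum_le_sum_of_subset_of_nonneg hBA fun p hp _ => hwnn p (by
            rcases mem_union.mp hp with h | h
            · exact hprimeA p h
            · exact hprimeS _ p h)
      _ ≤ ∑ p ∈ A, w p + ∑ p ∈ ({⌊u⌋₊} : Finset ℕ).filter Nat.Prime, w p :=
          sum_union_le_of_nonneg fun p hp => hwnn p (hprimeA p (mem_inter.mp hp).1)
      _ ≤ ∑ p ∈ A, w p + 8 * Real.log u := by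
          have := sum_filter_singleton_primeWt_le (x := u) (n := ⌊u⌋₊)
            (Nat.floor_le hu0) (Nat.le_floor (by norm_num; linarith))
          linarith
  rw [hSA, hSB, abs_le]
  constructor <;> linarith

variable {c C₀ : ℝ}

/-- **The case of one prime** (Lemma 4.10 for `m = 1`: "For `m = 1` the result is an immediate
consequence of the Prime Ideal Theorem, in the form given by (2.3)", p. 27; here from the degree-one
prime number theorem `|θ₁(x) − x| ≤ C₀ x exp(−c√(log x))` of the tree,
`Literature.NumberTheory.LFunctions.NumberField.abs_degreeOneTheta_sub_self_le`): for `3 ≤ lo ≤ hi`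
and `Y > 0`, `|∑_{P ∈ F, N(P) ≤ Y} log N(P) − meas([lo, hi) ∩ [0, Y])| ≤ (2C₀ + 32) Y exp(−c√(log lo))`
(`0 ≤ c ≤ 1`). [cite: HeathBrownActa2001, Lemma 4.10] -/
theorem abs_windowSum_sub_meas_le
    (hθ : ∀ x : ℝ, 2 ≤ x → |degreeOneTheta K x - x| ≤ C₀ * x * Real.exp (-c * Real.sqrt (Real.log x)))
    (hc0 : 0 ≤ c) (hc1 : c ≤ 1) (hC₀ : 0 ≤ C₀) {F : Finset (Ideal (𝓞 K))} {lo hi : ℝ}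
    (hF : ∀ P, P ∈ F ↔ P.IsPrime ∧ P ≠ ⊥ ∧ lo ≤ (Ideal.absNorm P : ℝ) ∧
      (Ideal.absNorm P : ℝ) < hi ∧ (Ideal.absNorm P).Prime)
    (hlo : 3 ≤ lo) (hlohi : lo ≤ hi) {Y : ℝ} (hY : 0 < Y) :
    |(∑ P ∈ F, if (Ideal.absNorm P : ℝ) ≤ Y then Real.log (Ideal.absNorm P) else 0) -
        max 0 (min Y hi - lo)| ≤ (2 * C₀ + 32) * Y * Real.exp (-c * Real.sqrt (Real.log lo)) := by
  have hε0 : 0 < Real.exp (-c * Real.sqrt (Real.log lo)) := Real.exp_pos _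
  rcases lt_or_ge Y lo with hYlo | hYlo
  · -- empty sum, empty interval
    have hsum : (∑ P ∈ F, if (Ideal.absNorm P : ℝ) ≤ Y then Real.log (Ideal.absNorm P) else 0) = 0 := by
      refine sum_eq_zero fun P hP => ?_
      obtain ⟨-, -, h1, -, -⟩ := (hF P).mp hP
      rw [if_neg (by linarith)]
    have hmax : max 0 (min Y hi - lo) = 0 := max_eq_left (by linarith [min_le_left Y hi])
    rw [hsum, hmax, sub_zero, abs_zero]
    positivity
  · set u := min Y hi with hu
    have hlou : lo ≤ u := le_min hYlo hlohi
    have hu3 : 3 ≤ u := hlo.trans hlou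
    have huY : u ≤ Y := min_le_left _ _
    have hmax : max 0 (min Y hi - lo) = u - lo := by rw [max_eq_right (sub_nonneg.mpr hlou)]
    have h1 := abs_windowSum_sub_theta_le hF hlo hlohi hYlo
    have hEu := hθ u (by linarith)
    have hElo := hθ lo (by linarith)
    -- monotonicity of the error factor
    have hexp : Real.exp (-c * Real.sqrt (Real.log u)) ≤ Real.exp (-c * Real.sqrt (Real.log lo)) := by
      refine Real.exp_le_exp.mpr ?_
      have : Real.sqrt (Real.log lo) ≤ Real.sqrt (Real.log u) :=
        Real.sqrt_le_sqrt (Real.log_le_log (by linarith) hlou)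
      nlinarith
    have hlogu : Real.log u ≤ 4 * u * Real.exp (-c * Real.sqrt (Real.log u)) := by
      have := log_le_mul_exp_neg hc1 (u := u) (by linarith)
      rwa [neg_mul]
    rw [hmax]
    calc |(∑ P ∈ F, if (Ideal.absNorm P : ℝ) ≤ Y then Real.log (Ideal.absNorm P) else 0) - (u - lo)|
        ≤ |(∑ P ∈ F, if (Ideal.absNorm P : ℝ) ≤ Y then Real.log (Ideal.absNorm P) else 0) -
            (degreeOneTheta K u - degreeOneTheta K lo)| +
          |degreeOneTheta K u - u| + |degreeOneTheta K lo - lo| := by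
          have := abs_sub_le ((∑ P ∈ F, if (Ideal.absNorm P : ℝ) ≤ Y then Real.log (Ideal.absNorm P) else 0))
            (degreeOneTheta K u - degreeOneTheta K lo) (u - lo)
          have h2 : |degreeOneTheta K u - degreeOneTheta K lo - (u - lo)| ≤
              |degreeOneTheta K u - u| + |degreeOneTheta K lo - lo| := by
            rw [show degreeOneTheta K u - degreeOneTheta K lo - (u - lo) =
              (degreeOneTheta K u - u) - (degreeOneTheta K lo - lo) by ring]
            exact abs_sub _ _
          linarith
      _ ≤ 8 * Real.log u + C₀ * u * Real.exp (-c * Real.sqrt (Real.log u)) +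
            C₀ * lo * Real.exp (-c * Real.sqrt (Real.log lo)) := by linarith
      _ ≤ 32 * Y * Real.exp (-c * Real.sqrt (Real.log lo)) +
            C₀ * Y * Real.exp (-c * Real.sqrt (Real.log lo)) +
            C₀ * Y * Real.exp (-c * Real.sqrt (Real.log lo)) := by
          have hA : Real.log u ≤ 4 * Y * Real.exp (-c * Real.sqrt (Real.log lo)) :=
            hlogu.trans (by gcongr)
          have hB : C₀ * u * Real.exp (-c * Real.sqrt (Real.log u)) ≤
              C₀ * Y * Real.exp (-c * Real.sqrt (Real.log lo)) := by gcongr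
          have hC : C₀ * lo * Real.exp (-c * Real.sqrt (Real.log lo)) ≤
              C₀ * Y * Real.exp (-c * Real.sqrt (Real.log lo)) := by gcongr
          linarith
      _ = (2 * C₀ + 32) * Y * Real.exp (-c * Real.sqrt (Real.log lo)) := by ring

/-- The error factor `exp(−c√(log t))` is nonincreasing in `t ≥ lo ≥ 1` (`c ≥ 0`). [folklore] -/
theorem exp_neg_sqrt_log_antitone (hc0 : 0 ≤ c) {lo t : ℝ} (hlo : 1 ≤ lo) (ht : lo ≤ t) :
    Real.exp (-c * Real.sqrt (Real.log t)) ≤ Real.exp (-c * Real.sqrt (Real.log lo)) := by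
  refine Real.exp_le_exp.mpr ?_
  have : Real.sqrt (Real.log lo) ≤ Real.sqrt (Real.log t) :=
    Real.sqrt_le_sqrt (Real.log_le_log (by linarith) ht)
  nlinarith

/-- `θ₁(x) = ∑_{k ≤ ⌊x⌋} [k prime] c_K(k) log k` (the form used with Abel summation). [folklore] -/
theorem degreeOneTheta_eq_sum_Icc (x : ℝ) :
    degreeOneTheta K x =
      ∑ k ∈ Finset.Icc 0 ⌊x⌋₊, (if k.Prime then (idealNormCount K k : ℝ) * Real.log k else 0) := by
  unfold degreeOneTheta
  rw [Nat.primesLE_eq_filter_Icc_zero, sum_filter]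

/-- **The window sum `∑ log N(P)/N(P)` with the sharp constant** ("`∑_{N(P_i)∈J_i} log N(P_i)/N(P_i)
≤ c₆ + log a_iϱ − log a_i = c₆ + log ϱ`", p. 27, the step whose constant `1` in front of `log ϱ` is what
makes the induction close): if `|θ₁(x) − x| ≤ C₀ x exp(−c√(log x))` for `x ≥ 2` (`c ≥ 0`), then for
`3 ≤ lo ≤ hi`, `∑_{P ∈ F} log N(P)/N(P) ≤ (1 + C₀ exp(−c√(log lo))) log(hi/lo) + (8 + 2C₀)` — Abel
summation (`sum_mul_eq_sub_sub_integral_mul` with `f(t) = 1/t`): `θ₁(hi)/hi − θ₁(lo)/lo + ∫ θ₁(t) dt/t²`.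
[cite: HeathBrownActa2001, Lemma 4.10] -/
theorem sum_log_div_absNorm_le
    (hθ : ∀ x : ℝ, 2 ≤ x → |degreeOneTheta K x - x| ≤ C₀ * x * Real.exp (-c * Real.sqrt (Real.log x)))
    (hc0 : 0 ≤ c) (hC₀ : 0 ≤ C₀) {F : Finset (Ideal (𝓞 K))} {lo hi : ℝ}
    (hF : ∀ P, P ∈ F ↔ P.IsPrime ∧ P ≠ ⊥ ∧ lo ≤ (Ideal.absNorm P : ℝ) ∧
      (Ideal.absNorm P : ℝ) < hi ∧ (Ideal.absNorm P).Prime)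
    (hlo : 3 ≤ lo) (hlohi : lo ≤ hi) :
    ∑ P ∈ F, Real.log (Ideal.absNorm P) / (Ideal.absNorm P) ≤
      (1 + C₀ * Real.exp (-c * Real.sqrt (Real.log lo))) * Real.log (hi / lo) + (8 + 2 * C₀) := by
  classical
  have hlo0 : 0 < lo := by linarith
  have hhi0 : 0 < hi := hlo0.trans_le hlohi
  set ε : ℝ → ℝ := fun t => Real.exp (-c * Real.sqrt (Real.log t)) with hε
  have hε0 : ∀ t, 0 < ε t := fun t => Real.exp_pos _
  have hε1 : ∀ t, ε t ≤ 1 := fun t => by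
    simp only [hε]
    rw [← Real.exp_zero]
    exact Real.exp_le_exp.mpr (by nlinarith [Real.sqrt_nonneg (Real.log t)])
  set cc : ℕ → ℝ := fun k => if k.Prime then (idealNormCount K k : ℝ) * Real.log k else 0 with hcc
  have hcc0 : ∀ k, 0 ≤ cc k := fun k => primeWt_nonneg k
  -- the prime form of the sum, and the comparison set
  set PI := (Finset.Ico ⌈lo⌉₊ ⌈hi⌉₊).filter Nat.Prime with hPI
  set B := (Finset.Ioc ⌊lo⌋₊ ⌊hi⌋₊).filter Nat.Prime with hB
  have hsum : ∑ P ∈ F, Real.log (Ideal.absNorm P) / (Ideal.absNorm P) =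
      ∑ p ∈ PI, cc p / p := by
    rw [sum_firstDeg_eq_sum_primes hF (fun n : ℕ => Real.log n / n)]
    refine sum_congr rfl fun p hp => ?_
    rw [hcc]
    simp only [if_pos (mem_filter.mp hp).2]
    ring
  have hPIB : PI ⊆ B ∪ ({⌊lo⌋₊} : Finset ℕ).filter Nat.Prime := by
    intro p hp
    have hp' := mem_filter.mp hp
    obtain ⟨h1, h2⟩ := Finset.mem_Ico.mp hp'.1
    have hpp := hp'.2
    have hlop : lo ≤ p := Nat.ceil_le.mp h1
    have hphi : (p : ℝ) < hi := Nat.lt_ceil.mp h2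
    rcases hlop.lt_or_eq with hlt | heq
    · exact mem_union_left _ (mem_filter.mpr
        ⟨Finset.mem_Ioc.mpr ⟨(Nat.floor_lt hlo0.le).mpr hlt, Nat.le_floor hphi.le⟩, hpp⟩)
    · refine mem_union_right _ (mem_filter.mpr ⟨mem_singleton.mpr ?_, hpp⟩)
      rw [heq, Nat.floor_natCast]
  have hterm0 : ∀ p : ℕ, 0 ≤ cc p / p := fun p => div_nonneg (hcc0 p) (Nat.cast_nonneg _)
  -- the single extra prime contributes at most 8
  have hsing : ∑ p ∈ ({⌊lo⌋₊} : Finset ℕ).filter Nat.Prime, cc p / p ≤ 8 := by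
    rw [sum_filter, sum_singleton]
    split_ifs with hp
    · rw [hcc]
      simp only [if_pos hp]
      have hp0 : (0 : ℝ) < ⌊lo⌋₊ := by exact_mod_cast hp.pos
      have hlog : Real.log (⌊lo⌋₊ : ℝ) ≤ ⌊lo⌋₊ := (Real.log_le_sub_one_of_pos hp0).trans (by linarith)
      rw [div_le_iff₀ hp0]
      calc (idealNormCount K ⌊lo⌋₊ : ℝ) * Real.log ⌊lo⌋₊ ≤ 8 * Real.log ⌊lo⌋₊ :=
            mul_le_mul_of_nonneg_right (idealNormCount_le_eight hp) (Real.log_nonneg (by exact_mod_cast hp.one_lt.le))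
        _ ≤ 8 * ⌊lo⌋₊ := by linarith
    · norm_num
  -- Abel summation on `B`
  set f : ℝ → ℝ := fun t => t⁻¹ with hf
  have hBsum : ∑ p ∈ B, cc p / p = ∑ k ∈ Finset.Ioc ⌊lo⌋₊ ⌊hi⌋₊, f k * cc k := by
    rw [hB, sum_filter]
    refine sum_congr rfl fun k _ => ?_
    by_cases hk : k.Prime
    · rw [if_pos hk, hf]; simp only; rw [div_eq_inv_mul]
    · rw [if_neg hk, hcc]; simp only [if_neg hk, mul_zero]
  have hf_diff : ∀ t ∈ Set.Icc lo hi, DifferentiableAt ℝ f t := fun t ht =>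
    (differentiableAt_inv_iff.mpr (by linarith [ht.1] : t ≠ 0))
  have hderiv : deriv f = fun t => -(t ^ 2)⁻¹ := deriv_inv'
  have hcont' : ContinuousOn (fun t : ℝ => -(t ^ 2)⁻¹) (Set.Icc lo hi) := by
    refine ContinuousOn.neg (ContinuousOn.inv₀ (continuousOn_id.pow 2) fun t ht => ?_)
    exact pow_ne_zero _ (by linarith [ht.1])
  have hf_int : IntegrableOn (deriv f) (Set.Icc lo hi) := by
    rw [hderiv]; exact hcont'.integrableOn_Icc
  have habel := sum_mul_eq_sub_sub_integral_mul cc hlo0.le hlohi hf_diff hf_int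
  rw [← degreeOneTheta_eq_sum_Icc, ← degreeOneTheta_eq_sum_Icc] at habel
  have hIθ : ∫ t in Set.Ioc lo hi, deriv f t * ∑ k ∈ Finset.Icc 0 ⌊t⌋₊, cc k =
      ∫ t in Set.Ioc lo hi, deriv f t * degreeOneTheta K t := by
    refine setIntegral_congr_fun measurableSet_Ioc fun t _ => ?_
    rw [degreeOneTheta_eq_sum_Icc]
  rw [hIθ] at habel
  -- the integral term: `∫_{(lo,hi]} θ₁(t)/t² ≤ (1 + C₀ ε(lo)) log(hi/lo)`
  have hθle : ∀ t, 2 ≤ t → degreeOneTheta K t ≤ t + C₀ * t * ε t := fun t ht => by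
    have := (abs_le.mp (hθ t ht)).2; simp only [hε]; linarith
  have hθge : ∀ t, 2 ≤ t → t - C₀ * t * ε t ≤ degreeOneTheta K t := fun t ht => by
    have := (abs_le.mp (hθ t ht)).1; simp only [hε]; linarith
  have hθnn : ∀ t, 0 ≤ degreeOneTheta K t := fun t =>
    Literature.NumberTheory.LFunctions.NumberField.degreeOneTheta_nonneg K t
  have hmeasθ : Measurable (degreeOneTheta K) :=
    Literature.NumberTheory.LFunctions.ThetaMertens.measurable_thetaWeight (fun p => (idealNormCount K p : ℝ))
  have hint1 : IntegrableOn (fun t : ℝ => (t ^ 2)⁻¹ * degreeOneTheta K t) (Set.Ioc lo hi) := by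
    haveI : IsFiniteMeasure ((volume : Measure ℝ).restrict (Set.Ioc lo hi)) :=
      ⟨by rw [Measure.restrict_apply_univ, Real.volume_Ioc]; exact ENNReal.ofReal_lt_top⟩
    refine Integrable.mono' (integrable_const ((lo ^ 2)⁻¹ * ((1 + C₀) * hi)))
      (((measurable_id.pow_const 2).inv).mul hmeasθ).aestronglyMeasurable ?_
    refine (ae_restrict_iff' measurableSet_Ioc).mpr (Eventually.of_forall fun t ht => ?_)
    have ht0 : 0 < t := hlo0.trans ht.1
    rw [Real.norm_eq_abs, abs_mul, abs_of_pos (inv_pos.mpr (pow_pos ht0 2)), abs_of_nonneg (hθnn t)]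
    have h1 : (t ^ 2)⁻¹ ≤ (lo ^ 2)⁻¹ := by
      rw [inv_le_inv₀ (pow_pos ht0 2) (pow_pos hlo0 2)]
      exact pow_le_pow_left₀ hlo0.le ht.1.le 2
    have h2 : degreeOneTheta K t ≤ (1 + C₀) * hi := by
      calc degreeOneTheta K t ≤ t + C₀ * t * ε t := hθle t (by linarith [ht.1])
        _ ≤ t + C₀ * t * 1 := by gcongr; exact hε1 t
        _ = (1 + C₀) * t := by ring
        _ ≤ (1 + C₀) * hi := by gcongr; exact ht.2
    exact mul_le_mul h1 h2 (hθnn t) (by positivity)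
  have hint2 : IntegrableOn (fun t : ℝ => (1 + C₀ * ε lo) * t⁻¹) (Set.Ioc lo hi) := by
    refine ContinuousOn.integrableOn_Icc ?_ |>.mono_set Set.Ioc_subset_Icc_self
    exact (ContinuousOn.inv₀ continuousOn_id fun t ht => by linarith [ht.1] : ContinuousOn (fun t : ℝ => t⁻¹) (Set.Icc lo hi)).const_smul (1 + C₀ * ε lo) |>.congr (fun t _ => by simp [smul_eq_mul])
  have hIle : ∫ t in Set.Ioc lo hi, (t ^ 2)⁻¹ * degreeOneTheta K t ≤ (1 + C₀ * ε lo) * Real.log (hi / lo) := by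
    calc ∫ t in Set.Ioc lo hi, (t ^ 2)⁻¹ * degreeOneTheta K t
        ≤ ∫ t in Set.Ioc lo hi, (1 + C₀ * ε lo) * t⁻¹ := by
          refine setIntegral_mono_on hint1 hint2 measurableSet_Ioc fun t ht => ?_
          have ht0 : 0 < t := hlo0.trans ht.1
          have ht2 : 2 ≤ t := by linarith [ht.1]
          have hεt : ε t ≤ ε lo := exp_neg_sqrt_log_antitone hc0 (by linarith) ht.1.le
          calc (t ^ 2)⁻¹ * degreeOneTheta K t ≤ (t ^ 2)⁻¹ * (t + C₀ * t * ε t) :=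
                mul_le_mul_of_nonneg_left (hθle t ht2) (by positivity)
            _ = (1 + C₀ * ε t) * t⁻¹ := by field_simp
            _ ≤ (1 + C₀ * ε lo) * t⁻¹ := by gcongr
      _ = (1 + C₀ * ε lo) * Real.log (hi / lo) := by
          rw [integral_const_mul, ← intervalIntegral.integral_of_le hlohi, integral_inv_of_pos hlo0 hhi0]
  -- the boundary terms
  have hbhi : f hi * degreeOneTheta K hi ≤ 1 + C₀ * ε lo := by
    rw [hf]; simp only
    rw [inv_mul_le_iff₀ hhi0]
    calc degreeOneTheta K hi ≤ hi + C₀ * hi * ε hi := hθle hi (by linarith)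
      _ ≤ hi + C₀ * hi * ε lo := by gcongr; exact exp_neg_sqrt_log_antitone hc0 (by linarith) hlohi
      _ = hi * (1 + C₀ * ε lo) := by ring
  have hblo : -(f lo * degreeOneTheta K lo) ≤ -1 + C₀ * ε lo := by
    rw [hf]; simp only
    rw [neg_le, neg_add, neg_neg, ← sub_eq_add_neg, le_inv_mul_iff₀ hlo0]
    calc lo * (1 - C₀ * ε lo) = lo - C₀ * lo * ε lo := by ring
      _ ≤ degreeOneTheta K lo := hθge lo (by linarith)
  -- assemble
  have hIeq : ∫ t in Set.Ioc lo hi, deriv f t * degreeOneTheta K t =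
      -∫ t in Set.Ioc lo hi, (t ^ 2)⁻¹ * degreeOneTheta K t := by
    rw [← integral_neg]
    refine setIntegral_congr_fun measurableSet_Ioc fun t _ => ?_
    rw [hderiv]; ring
  calc ∑ P ∈ F, Real.log (Ideal.absNorm P) / (Ideal.absNorm P) = ∑ p ∈ PI, cc p / p := hsum
    _ ≤ ∑ p ∈ B ∪ ({⌊lo⌋₊} : Finset ℕ).filter Nat.Prime, cc p / p :=
        sum_le_sum_of_subset_of_nonneg hPIB fun p _ _ => hterm0 p
    _ ≤ ∑ p ∈ B, cc p / p + ∑ p ∈ ({⌊lo⌋₊} : Finset ℕ).filter Nat.Prime, cc p / p :=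
        sum_union_le_of_nonneg fun p _ => hterm0 p
    _ ≤ ∑ p ∈ B, cc p / p + 8 := by linarith [hsing]
    _ = f hi * degreeOneTheta K hi - f lo * degreeOneTheta K lo +
          (∫ t in Set.Ioc lo hi, (t ^ 2)⁻¹ * degreeOneTheta K t) + 8 := by
        rw [hBsum, habel, hIeq]; ring
    _ ≤ (1 + C₀ * ε lo) + (-1 + C₀ * ε lo) + (1 + C₀ * ε lo) * Real.log (hi / lo) + 8 := by
        linarith [hbhi, hblo, hIle]
    _ ≤ (1 + C₀ * Real.exp (-c * Real.sqrt (Real.log lo))) * Real.log (hi / lo) + (8 + 2 * C₀) := by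
        have : C₀ * ε lo ≤ C₀ * 1 := mul_le_mul_of_nonneg_left (hε1 lo) hC₀
        simp only [hε] at this ⊢
        linarith

end PrimeSums

/-! ### Lemma 4.10: prime tuples in a box, by induction on the number of primes -/

section Induction

/-- Splitting a sum over `piFinset S` (`S : Fin (n+1) → Finset α`) along the last coordinate
(`Finset.filter_piFinset_eq_map_snocEquiv`). [folklore] -/
theorem sum_piFinset_eq_sum_snoc {α : Type*} [DecidableEq α] {n : ℕ} (S : Fin (n + 1) → Finset α)
    (f : (Fin (n + 1) → α) → ℝ) :
    ∑ r ∈ Fintype.piFinset S, f r =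
      ∑ y ∈ S (Fin.last n), ∑ r' ∈ Fintype.piFinset (Fin.init S), f (Fin.snoc r' y) := by
  have h := Finset.filter_piFinset_eq_map_snocEquiv S (fun _ => True)
  rw [Finset.filter_true, Finset.filter_true] at h
  rw [h, sum_map, sum_product]
  rfl

/-- `∏_i g((snoc r' y)_i) = (∏_i g(r'_i)) · g(y)`. [folklore] -/
theorem prod_comp_snoc {α M : Type*} [CommMonoid M] {n : ℕ} (g : α → M) (r' : Fin n → α) (y : α) :
    ∏ i, g (Fin.snoc (α := fun _ => α) r' y i) = (∏ i, g (r' i)) * g y := by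
  rw [Fin.prod_univ_castSucc]
  simp only [Fin.snoc_castSucc, Fin.snoc_last]

/-- A measurable function bounded on `[c, d)` is integrable there. [folklore] -/
theorem integrableOn_Ico_of_bounded {f : ℝ → ℝ} (hf : Measurable f) {c d B : ℝ}
    (hB : ∀ y ∈ Ico c d, |f y| ≤ B) : IntegrableOn f (Ico c d) volume := by
  haveI : IsFiniteMeasure ((volume : Measure ℝ).restrict (Ico c d)) :=
    ⟨by rw [Measure.restrict_apply_univ, Real.volume_Ico]; exact ENNReal.ofReal_lt_top⟩
  refine Integrable.mono' (integrable_const B) hf.aestronglyMeasurable ?_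
  refine (ae_restrict_iff' measurableSet_Ico).mpr (Eventually.of_forall fun y hy => ?_)
  rw [Real.norm_eq_abs]; exact hB y hy

/-- `∫_{[c,d)} 1[y ≤ Z] L dy = L · (min Z d − c)⁺` (the slice length of `volume_Ico_inter_le`). [folklore] -/
theorem integral_Ico_ite_le_const (c d Z L : ℝ) :
    ∫ y in Ico c d, (if y ≤ Z then L else 0) = L * max 0 (min Z d - c) := by
  have hset : MeasurableSet {y : ℝ | y ≤ Z} := measurableSet_le measurable_id measurable_const
  have hfun : (fun y : ℝ => if y ≤ Z then L else 0) = Set.indicator {y | y ≤ Z} (fun _ => L) := by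
    funext y; simp only [Set.indicator, mem_setOf_eq]
  rw [hfun, integral_indicator hset, setIntegral_const, smul_eq_mul, mul_comm]
  congr 1
  rw [Measure.real, Measure.restrict_apply hset]
  have : {y : ℝ | y ≤ Z} ∩ Ico c d = {y : ℝ | y ∈ Ico c d ∧ y ≤ Z} := by
    ext y; simp only [mem_inter_iff, mem_setOf_eq]; exact and_comm
  rw [this, volume_Ico_inter_le, ENNReal.toReal_ofReal', max_comm]

/-- `u exp(−c√u) ≤ 4/c²` for `u ≥ 0`, `c > 0` (from `e^x ≥ 1 + x` at `x = c√u/2`). [folklore] -/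
theorem mul_exp_neg_sqrt_le {c u : ℝ} (hc : 0 < c) (hu : 0 ≤ u) :
    u * Real.exp (-c * Real.sqrt u) ≤ 4 / c ^ 2 := by
  have hs : 0 ≤ Real.sqrt u := Real.sqrt_nonneg u
  have h1 : 1 + c * Real.sqrt u / 2 ≤ Real.exp (c * Real.sqrt u / 2) := by
    have := Real.add_one_le_exp (c * Real.sqrt u / 2); linarith
  have h2 : c ^ 2 * u / 4 ≤ Real.exp (c * Real.sqrt u) := by
    have hsq : Real.exp (c * Real.sqrt u) = Real.exp (c * Real.sqrt u / 2) ^ 2 := by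
      rw [← Real.exp_nat_mul]; ring_nf
    rw [hsq]
    have h3 : (1 + c * Real.sqrt u / 2) ^ 2 ≤ Real.exp (c * Real.sqrt u / 2) ^ 2 :=
      pow_le_pow_left₀ (by positivity) h1 2
    have h4 : c ^ 2 * u / 4 ≤ (1 + c * Real.sqrt u / 2) ^ 2 := by
      have := Real.sq_sqrt hu
      nlinarith [mul_nonneg hc.le hs]
    linarith
  rw [neg_mul, Real.exp_neg, ← div_eq_mul_inv, div_le_div_iff₀ (Real.exp_pos _) (by positivity)]
  nlinarith

variable {c C₀ : ℝ}

/-- **Heath-Brown's Lemma 4.10, the induction with explicit constants.** Given the degree-one prime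
number theorem in the form `|θ₁(x) − x| ≤ C₀ x exp(−c√(log x))` (`x ≥ 2`, `0 < c ≤ 1`, `C₀ ≥ 0`): for
every `m = j + 1 ≥ 1`, intervals `[lo_i, hi_i)` with `3 ≤ Δ ≤ lo_i ≤ hi_i` and `log(hi_i/lo_i) ≤ Λ ≤ log Δ`
(`Λ ≥ 0`), the sets `F_i` of first-degree prime ideals with norm in `[lo_i, hi_i)`, and every `Y > 0`,
`|∑_{(P_i) ∈ ∏F_i, ∏N(P_i) ≤ Y} ∏ log N(P_i) − meas(J(Y, m))| ≤ C m Y (c₁ + Λ)^{m−1} exp(−c√(log Δ))` with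
`C = 2C₀ + 32`, `c₁ = 8 + 2C₀ + 4C₀/c²`. The proof is the printed induction (pp. 27–28): for `m + 1`
primes fix the first `m`, apply the case of one prime to the last one at the level `Y/∏N(P_i)` (error
(4.2), `c₅ Y exp(…) ∏_i ∑ log N(P_i)/N(P_i) ≤ c₅ Y exp(…)(c₆ + Λ)^m`), write the main term as
`∫_{J_{m+1}} [∑_{∏N(P_i) ≤ Y/t} ∏ log N(P_i)] dt`, apply the induction hypothesis inside the integral
(error (4.3), `∫ dt/t = log(hi/lo) ≤ Λ`) and Fubini `∫_{J_{m+1}} meas(J(Y/t, m)) dt = meas(J(Y, m+1))`;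
"providing that `c₃ ≥ c₅`, `c₁ ≥ c₆` and `c₂ ≤ c₄`" becomes `C = c₅`, `c₁ = c₆`.
[cite: HeathBrownActa2001, Lemma 4.10] -/
theorem lemma_4_10_aux
    (hθ : ∀ x : ℝ, 2 ≤ x → |degreeOneTheta K x - x| ≤ C₀ * x * Real.exp (-c * Real.sqrt (Real.log x)))
    (hc0 : 0 < c) (hc1 : c ≤ 1) (hC₀ : 0 ≤ C₀) :
    ∀ (j : ℕ) (lo hi : Fin (j + 1) → ℝ) (F : Fin (j + 1) → Finset (Ideal (𝓞 K))),
      (∀ i P, P ∈ F i ↔ P.IsPrime ∧ P ≠ ⊥ ∧ lo i ≤ (Ideal.absNorm P : ℝ) ∧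
        (Ideal.absNorm P : ℝ) < hi i ∧ (Ideal.absNorm P).Prime) →
      ∀ Δ : ℝ, 3 ≤ Δ → (∀ i, Δ ≤ lo i) → (∀ i, lo i ≤ hi i) →
      ∀ Λ : ℝ, 0 ≤ Λ → Λ ≤ Real.log Δ → (∀ i, Real.log (hi i / lo i) ≤ Λ) →
      ∀ Y : ℝ, 0 < Y →
        |(∑ P ∈ Fintype.piFinset F,
            if ∏ i, (Ideal.absNorm (P i) : ℝ) ≤ Y then ∏ i, Real.log (Ideal.absNorm (P i)) else 0) -
          (volume {x : Fin (j + 1) → ℝ | (∀ i, x i ∈ Ico (lo i) (hi i)) ∧ ∏ i, x i ≤ Y}).toReal| ≤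
        (2 * C₀ + 32) * ((j : ℝ) + 1) * Y * (8 + 2 * C₀ + 4 * C₀ / c ^ 2 + Λ) ^ j *
          Real.exp (-c * Real.sqrt (Real.log Δ)) := by
  set C : ℝ := 2 * C₀ + 32 with hCdef
  set c₁ : ℝ := 8 + 2 * C₀ + 4 * C₀ / c ^ 2 with hc₁def
  have hC : 0 ≤ C := by positivity
  have hc₁ : 0 ≤ c₁ := by positivity
  intro j
  induction j with
  | zero =>
    intro lo hi F hF Δ hΔ hΔlo hlohi Λ hΛ hΛΔ hΛi Y hY
    classical
    have hlo3 : 3 ≤ lo 0 := hΔ.trans (hΔlo 0)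
    have hlo0 : 0 < lo 0 := by linarith
    -- the tuple sum is the one-prime sum, the measure is the interval length
    have hT : (∑ P ∈ Fintype.piFinset F,
        if ∏ i, (Ideal.absNorm (P i) : ℝ) ≤ Y then ∏ i, Real.log (Ideal.absNorm (P i)) else 0) =
        ∑ Q ∈ F 0, if (Ideal.absNorm Q : ℝ) ≤ Y then Real.log (Ideal.absNorm Q) else 0 := by
      rw [sum_piFinset_eq_sum_snoc]
      refine sum_congr rfl fun Q _ => ?_
      rw [Fintype.piFinset_of_isEmpty, Fintype.sum_unique]
      simp only [prod_comp_snoc (fun P : Ideal (𝓞 K) => (Ideal.absNorm P : ℝ)),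
        prod_comp_snoc (fun P : Ideal (𝓞 K) => Real.log (Ideal.absNorm P)),
        Finset.univ_eq_empty, Finset.prod_empty, one_mul]
    have hW := toReal_volume_boxLE_one lo hi hlo0 Y
    rw [hT, hW]
    have hbase := abs_windowSum_sub_meas_le hθ hc0.le hc1 hC₀ (hF 0) hlo3 (hlohi 0) hY
    refine hbase.trans ?_
    have hε : Real.exp (-c * Real.sqrt (Real.log (lo 0))) ≤ Real.exp (-c * Real.sqrt (Real.log Δ)) :=
      exp_neg_sqrt_log_antitone hc0.le (by linarith) (hΔlo 0)
    calc (2 * C₀ + 32) * Y * Real.exp (-c * Real.sqrt (Real.log (lo 0)))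
        ≤ (2 * C₀ + 32) * Y * Real.exp (-c * Real.sqrt (Real.log Δ)) := by gcongr
      _ = C * (((0 : ℕ) : ℝ) + 1) * Y * (c₁ + Λ) ^ 0 * Real.exp (-c * Real.sqrt (Real.log Δ)) := by
          simp only [hCdef, Nat.cast_zero, zero_add, pow_zero]; ring
  | succ j ih =>
    intro lo hi F hF Δ hΔ hΔlo hlohi Λ hΛ hΛΔ hΛi Y hY
    classical
    -- data of the first `j + 1` coordinates and of the last one
    set lo' : Fin (j + 1) → ℝ := Fin.init lo with hlo'
    set hi' : Fin (j + 1) → ℝ := Fin.init hi with hhi'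
    set F' : Fin (j + 1) → Finset (Ideal (𝓞 K)) := Fin.init F with hF'def
    set cL := lo (Fin.last (j + 1)) with hcL
    set dL := hi (Fin.last (j + 1)) with hdL
    have hF' : ∀ i P, P ∈ F' i ↔ P.IsPrime ∧ P ≠ ⊥ ∧ lo' i ≤ (Ideal.absNorm P : ℝ) ∧
        (Ideal.absNorm P : ℝ) < hi' i ∧ (Ideal.absNorm P).Prime := fun i P => hF (Fin.castSucc i) P
    have hlo3 : ∀ i, 3 ≤ lo i := fun i => hΔ.trans (hΔlo i)
    have hlo0 : ∀ i, 0 < lo i := fun i => by linarith [hlo3 i]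
    have hcL3 : 3 ≤ cL := hlo3 _
    have hcL0 : 0 < cL := hlo0 _
    have hcdL : cL ≤ dL := hlohi _
    set ε : ℝ := Real.exp (-c * Real.sqrt (Real.log Δ)) with hεdef
    have hε0 : 0 < ε := Real.exp_pos _
    -- the tuple sum over `F'`, its level-`Z` version, the weights
    set L : (Fin (j + 1) → Ideal (𝓞 K)) → ℝ := fun r => ∏ i, Real.log (Ideal.absNorm (r i)) with hLdef
    set Nm : (Fin (j + 1) → Ideal (𝓞 K)) → ℝ := fun r => ∏ i, (Ideal.absNorm (r i) : ℝ) with hNmdef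
    set T' : ℝ → ℝ := fun Z => ∑ r ∈ Fintype.piFinset F', if Nm r ≤ Z then L r else 0 with hT'def
    set W' : ℝ → ℝ := fun Z => (volume {x : Fin (j + 1) → ℝ |
      (∀ i, x i ∈ Ico (lo' i) (hi' i)) ∧ ∏ i, x i ≤ Z}).toReal with hW'def
    have hmemF' : ∀ r ∈ Fintype.piFinset F', ∀ i, (Ideal.absNorm (r i)).Prime ∧ lo' i ≤ (Ideal.absNorm (r i) : ℝ) := by
      intro r hr i
      have := (hF' i (r i)).mp (Fintype.mem_piFinset.mp hr i)
      exact ⟨this.2.2.2.2, this.2.2.1⟩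
    have hNmpos : ∀ r ∈ Fintype.piFinset F', 0 < Nm r := fun r hr =>
      prod_pos fun i _ => by exact_mod_cast (hmemF' r hr i).1.pos
    have hLnn : ∀ r ∈ Fintype.piFinset F', 0 ≤ L r := fun r hr =>
      prod_nonneg fun i _ => Real.log_nonneg (by exact_mod_cast (hmemF' r hr i).1.one_lt.le)
    -- Step 1: split off the last prime
    have hsplit : (∑ P ∈ Fintype.piFinset F,
        if ∏ i, (Ideal.absNorm (P i) : ℝ) ≤ Y then ∏ i, Real.log (Ideal.absNorm (P i)) else 0) =
        ∑ r ∈ Fintype.piFinset F', L r *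
          ∑ Q ∈ F (Fin.last (j + 1)), if (Ideal.absNorm Q : ℝ) ≤ Y / Nm r then Real.log (Ideal.absNorm Q) else 0 := by
      rw [sum_piFinset_eq_sum_snoc, sum_comm]
      refine sum_congr rfl fun r hr => ?_
      rw [mul_sum]
      refine sum_congr rfl fun Q hQ => ?_
      rw [prod_comp_snoc (fun P : Ideal (𝓞 K) => (Ideal.absNorm P : ℝ)),
        prod_comp_snoc (fun P : Ideal (𝓞 K) => Real.log (Ideal.absNorm P))]
      have hP := hNmpos r hr
      simp only [hNmdef, hLdef]
      have hiff : (∏ i, (Ideal.absNorm (r i) : ℝ)) * (Ideal.absNorm Q : ℝ) ≤ Y ↔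
          (Ideal.absNorm Q : ℝ) ≤ Y / ∏ i, (Ideal.absNorm (r i) : ℝ) := by
        rw [le_div_iff₀ hP, mul_comm]
      by_cases hq : (Ideal.absNorm Q : ℝ) ≤ Y / ∏ i, (Ideal.absNorm (r i) : ℝ)
      · rw [if_pos (hiff.mpr hq), if_pos hq]
      · rw [if_neg (fun h => hq (hiff.mp h)), if_neg hq, mul_zero]
    -- Step 2: the one-prime estimate inside, error `R₁`
    have hstep2 : |(∑ r ∈ Fintype.piFinset F', L r *
          ∑ Q ∈ F (Fin.last (j + 1)), if (Ideal.absNorm Q : ℝ) ≤ Y / Nm r then Real.log (Ideal.absNorm Q) else 0) -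
        ∑ r ∈ Fintype.piFinset F', L r * max 0 (min (Y / Nm r) dL - cL)| ≤
        C * Y * ε * ∑ r ∈ Fintype.piFinset F', ∏ i, (Real.log (Ideal.absNorm (r i)) / (Ideal.absNorm (r i) : ℝ)) := by
      rw [← sum_sub_distrib, mul_sum]
      refine (abs_sum_le_sum_abs _ _).trans (sum_le_sum fun r hr => ?_)
      have hP := hNmpos r hr
      rw [← mul_sub, abs_mul, abs_of_nonneg (hLnn r hr)]
      have hb := abs_windowSum_sub_meas_le hθ hc0.le hc1 hC₀ (hF (Fin.last (j + 1))) hcL3 hcdL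
        (div_pos hY hP)
      have hε' : Real.exp (-c * Real.sqrt (Real.log cL)) ≤ ε := exp_neg_sqrt_log_antitone hc0.le (by linarith) (hΔlo _)
      calc L r * |(∑ Q ∈ F (Fin.last (j + 1)), if (Ideal.absNorm Q : ℝ) ≤ Y / Nm r then Real.log (Ideal.absNorm Q) else 0) -
              max 0 (min (Y / Nm r) dL - cL)|
          ≤ L r * ((2 * C₀ + 32) * (Y / Nm r) * Real.exp (-c * Real.sqrt (Real.log cL))) :=
            mul_le_mul_of_nonneg_left hb (hLnn r hr)
        _ ≤ L r * ((2 * C₀ + 32) * (Y / Nm r) * ε) := by gcongr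
        _ = C * Y * ε * (L r / Nm r) := by simp only [hCdef]; field_simp
        _ = C * Y * ε * ∏ i, (Real.log (Ideal.absNorm (r i)) / (Ideal.absNorm (r i) : ℝ)) := by
            simp only [hLdef, hNmdef, prod_div_distrib]
    -- Step 3: the window sums `∑ log N(P)/N(P) ≤ c₁ + Λ`, so `R₁ ≤ C Y ε (c₁ + Λ)^{j+1}`
    have hwin : ∀ i, ∑ P ∈ F' i, Real.log (Ideal.absNorm P) / (Ideal.absNorm P) ≤ c₁ + Λ := by
      intro i
      have h := sum_log_div_absNorm_le hθ hc0.le hC₀ (hF' i) (hlo3 _) (hlohi _)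
      have hεi : Real.exp (-c * Real.sqrt (Real.log (lo' i))) ≤ ε :=
        exp_neg_sqrt_log_antitone hc0.le (by linarith) (hΔlo _)
      have hΛi' : Real.log (hi' i / lo' i) ≤ Λ := hΛi _
      have hlognn : 0 ≤ Real.log (hi' i / lo' i) :=
        Real.log_nonneg ((one_le_div (hlo0 _)).mpr (hlohi _))
      have hu := mul_exp_neg_sqrt_le hc0 (Real.log_nonneg (by linarith : (1 : ℝ) ≤ Δ))
      calc ∑ P ∈ F' i, Real.log (Ideal.absNorm P) / (Ideal.absNorm P)
          ≤ (1 + C₀ * Real.exp (-c * Real.sqrt (Real.log (lo' i)))) * Real.log (hi' i / lo' i) + (8 + 2 * C₀) := h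
        _ ≤ (1 + C₀ * ε) * Λ + (8 + 2 * C₀) := by gcongr
        _ = Λ + C₀ * (Λ * ε) + (8 + 2 * C₀) := by ring
        _ ≤ Λ + C₀ * (Real.log Δ * ε) + (8 + 2 * C₀) := by gcongr
        _ ≤ Λ + C₀ * (4 / c ^ 2) + (8 + 2 * C₀) := by gcongr
        _ = c₁ + Λ := by simp only [hc₁def]; ring
    have hR₁ : C * Y * ε * ∑ r ∈ Fintype.piFinset F', ∏ i, (Real.log (Ideal.absNorm (r i)) / (Ideal.absNorm (r i) : ℝ)) ≤
        C * Y * ε * (c₁ + Λ) ^ (j + 1) := by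
      refine mul_le_mul_of_nonneg_left ?_ (by positivity)
      rw [← Finset.prod_univ_sum (fun i => F' i) (fun i P => Real.log (Ideal.absNorm P) / (Ideal.absNorm P : ℝ))]
      calc ∏ i, ∑ P ∈ F' i, Real.log (Ideal.absNorm P) / (Ideal.absNorm P : ℝ) ≤ ∏ _i : Fin (j + 1), (c₁ + Λ) :=
            prod_le_prod (fun i _ => sum_nonneg fun P hP => div_nonneg
              (Real.log_nonneg (by exact_mod_cast ((hF' i P).mp hP).2.2.2.2.one_lt.le)) (Nat.cast_nonneg _))
              fun i _ => hwin i
        _ = (c₁ + Λ) ^ (j + 1) := by rw [prod_const, card_univ, Fintype.card_fin]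
    -- Step 4: the main term is the integral of `T'(Y/y)` over the last interval
    have hmain : ∑ r ∈ Fintype.piFinset F', L r * max 0 (min (Y / Nm r) dL - cL) =
        ∫ y in Ico cL dL, T' (Y / y) := by
      have hint : ∀ r ∈ Fintype.piFinset F', IntegrableOn (fun y : ℝ => if Nm r ≤ Y / y then L r else 0) (Ico cL dL) volume := by
        intro r hr
        refine integrableOn_Ico_of_bounded (Measurable.ite (measurableSet_le measurable_const
          (measurable_const.div measurable_id)) measurable_const measurable_const) (B := L r) fun y _ => ?_
        split_ifs <;> simp [abs_of_nonneg (hLnn r hr), hLnn r hr]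
      simp only [hT'def]
      rw [integral_finsetSum _ hint]
      refine sum_congr rfl fun r hr => ?_
      have hP := hNmpos r hr
      have hcongr : ∀ y ∈ Ico cL dL, (if Nm r ≤ Y / y then L r else 0) = (if y ≤ Y / Nm r then L r else 0) := by
        intro y hy
        have hy0 : 0 < y := hcL0.trans_le hy.1
        have hiff : Nm r ≤ Y / y ↔ y ≤ Y / Nm r := by rw [le_div_iff₀ hy0, le_div_iff₀ hP, mul_comm]
        exact if_congr hiff rfl rfl
      rw [setIntegral_congr_fun measurableSet_Ico hcongr, integral_Ico_ite_le_const]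
    -- Step 5: the induction hypothesis inside the integral, and Fubini for the measure
    have hIH : ∀ y ∈ Ico cL dL, |T' (Y / y) - W' (Y / y)| ≤ C * ((j : ℝ) + 1) * (Y / y) * (c₁ + Λ) ^ j * ε := by
      intro y hy
      have hy0 : 0 < y := hcL0.trans_le hy.1
      exact ih lo' hi' F' hF' Δ hΔ (fun i => hΔlo _) (fun i => hlohi _) Λ hΛ hΛΔ (fun i => hΛi _) (Y / y) (div_pos hY hy0)
    have hWfub : (volume {x : Fin (j + 1 + 1) → ℝ | (∀ i, x i ∈ Ico (lo i) (hi i)) ∧ ∏ i, x i ≤ Y}).toReal =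
        ∫ y in Ico cL dL, W' (Y / y) := toReal_volume_boxLE_eq_integral_last lo hi hlo0 Y
    -- integrability of `T'(Y/·)` and `W'(Y/·)` on the last interval
    have hT'int : IntegrableOn (fun y => T' (Y / y)) (Ico cL dL) volume := by
      have : (fun y => T' (Y / y)) = fun y => ∑ r ∈ Fintype.piFinset F', if Nm r ≤ Y / y then L r else 0 := by
        funext y; simp only [hT'def]
      rw [this]
      refine integrable_finsetSum _ fun r hr => ?_
      refine integrableOn_Ico_of_bounded (Measurable.ite (measurableSet_le measurable_const
        (measurable_const.div measurable_id)) measurable_const measurable_const) (B := L r) fun y _ => ?_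
      split_ifs <;> simp [abs_of_nonneg (hLnn r hr), hLnn r hr]
    have hW'int : IntegrableOn (fun y => W' (Y / y)) (Ico cL dL) volume := by
      have hmeas : Measurable (fun y => W' (Y / y)) :=
        (monotone_toReal_volume_boxLE lo' hi').measurable.comp (measurable_const.div measurable_id)
      refine integrableOn_Ico_of_bounded (f := fun y => W' (Y / y)) hmeas
        (B := (volume (Set.univ.pi fun i : Fin (j + 1) => Ico (lo' i) (hi' i))).toReal) fun y _ => ?_
      simp only [hW'def]
      rw [abs_of_nonneg ENNReal.toReal_nonneg]
      exact ENNReal.toReal_mono (volume_box_lt_top _ _).ne (volume_boxLE_le_volume_box _ _ _)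
    have hstep5 : |(∫ y in Ico cL dL, T' (Y / y)) - ∫ y in Ico cL dL, W' (Y / y)| ≤
        C * ((j : ℝ) + 1) * Y * (c₁ + Λ) ^ j * ε * Λ := by
      rw [← integral_sub hT'int hW'int]
      have hbint : IntegrableOn (fun y : ℝ => C * ((j : ℝ) + 1) * Y * (c₁ + Λ) ^ j * ε * y⁻¹) (Ico cL dL) volume := by
        refine (ContinuousOn.integrableOn_Icc ?_).mono_set Set.Ico_subset_Icc_self
        exact continuousOn_const.mul (ContinuousOn.inv₀ continuousOn_id fun y hy => by linarith [hy.1])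
      calc |∫ y in Ico cL dL, (T' (Y / y) - W' (Y / y))|
          ≤ ∫ y in Ico cL dL, C * ((j : ℝ) + 1) * Y * (c₁ + Λ) ^ j * ε * y⁻¹ := by
            refine (abs_integral_le_integral_abs).trans (setIntegral_mono_on (hT'int.sub hW'int).abs hbint
              measurableSet_Ico fun y hy => ?_)
            have hy0 : 0 < y := hcL0.trans_le hy.1
            refine (hIH y hy).trans (le_of_eq ?_)
            field_simp
        _ = C * ((j : ℝ) + 1) * Y * (c₁ + Λ) ^ j * ε * Real.log (dL / cL) := by
            rw [integral_const_mul, integral_Ico_eq_integral_Ioc, ← intervalIntegral.integral_of_le hcdL,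
              integral_inv_of_pos hcL0 (hcL0.trans_le hcdL)]
        _ ≤ C * ((j : ℝ) + 1) * Y * (c₁ + Λ) ^ j * ε * Λ := by
            refine mul_le_mul_of_nonneg_left (hΛi (Fin.last (j + 1))) (by positivity)
    -- Step 6: assemble
    have hfinal : C * Y * ε * (c₁ + Λ) ^ (j + 1) + C * ((j : ℝ) + 1) * Y * (c₁ + Λ) ^ j * ε * Λ ≤
        C * (((j + 1 : ℕ) : ℝ) + 1) * Y * (c₁ + Λ) ^ (j + 1) * ε := by
      have hΛle : Λ ≤ c₁ + Λ := by linarith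
      have hpow : (c₁ + Λ) ^ j * Λ ≤ (c₁ + Λ) ^ (j + 1) := by
        rw [pow_succ]; exact mul_le_mul_of_nonneg_left hΛle (pow_nonneg (by positivity) _)
      push_cast
      nlinarith [mul_nonneg (mul_nonneg (mul_nonneg hC (by positivity : (0 : ℝ) ≤ (j : ℝ) + 1)) hY.le) hε0.le, hpow]
    calc |(∑ P ∈ Fintype.piFinset F,
            if ∏ i, (Ideal.absNorm (P i) : ℝ) ≤ Y then ∏ i, Real.log (Ideal.absNorm (P i)) else 0) -
          (volume {x : Fin (j + 1 + 1) → ℝ | (∀ i, x i ∈ Ico (lo i) (hi i)) ∧ ∏ i, x i ≤ Y}).toReal|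
        = |((∑ r ∈ Fintype.piFinset F', L r *
              ∑ Q ∈ F (Fin.last (j + 1)), if (Ideal.absNorm Q : ℝ) ≤ Y / Nm r then Real.log (Ideal.absNorm Q) else 0) -
            ∑ r ∈ Fintype.piFinset F', L r * max 0 (min (Y / Nm r) dL - cL)) +
            ((∫ y in Ico cL dL, T' (Y / y)) - ∫ y in Ico cL dL, W' (Y / y))| := by
          rw [hsplit, hWfub, ← hmain]; congr 1; ring
      _ ≤ |(∑ r ∈ Fintype.piFinset F', L r *
              ∑ Q ∈ F (Fin.last (j + 1)), if (Ideal.absNorm Q : ℝ) ≤ Y / Nm r then Real.log (Ideal.absNorm Q) else 0) -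
            ∑ r ∈ Fintype.piFinset F', L r * max 0 (min (Y / Nm r) dL - cL)| +
            |(∫ y in Ico cL dL, T' (Y / y)) - ∫ y in Ico cL dL, W' (Y / y)| := abs_add_le _ _
      _ ≤ C * Y * ε * (c₁ + Λ) ^ (j + 1) + C * ((j : ℝ) + 1) * Y * (c₁ + Λ) ^ j * ε * Λ :=
          add_le_add (hstep2.trans hR₁) hstep5
      _ ≤ C * (((j + 1 : ℕ) : ℝ) + 1) * Y * (c₁ + Λ) ^ (j + 1) * ε := hfinal

/-- **Heath-Brown's Lemma 4.10** (p. 27): "Let `J_1, …, J_m` be intervals of the form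
`J_i = [a_i, ϱa_i)`, with `ϱ > 1` and `a_i ≥ Δ > 1` for each `i ≤ m`. Let `Y ≥ 1` be given and define
`J(Y, m) ⊆ ℝ^m` as the set of `(x_1, …, x_m)` with `x_i ∈ J_i` and `∏ x_i ≤ Y`. Then there are positive
absolute constants `c₁` and `c₂` such that
`∑_{(N(P_1),…,N(P_m)) ∈ J(Y,m)} ∏_{i=1}^m log N(P_i) = meas(J(Y, m)) + O(mY(c₁ + log ϱ)^{m−1} exp{−c₂(log Δ)^{1/2}})`,
uniformly in `m`." PROVED here, for `K = ℚ(2^{1/3})`, in the following form: the sum runs over ordered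
tuples of FIRST-DEGREE prime ideals (those that occur in the application to `ℬ^(K)`, pp. 17, 64, where
"only prime ideals of first degree may divide `S`"; the version over all prime ideals differs by the
primes of degree `≥ 2`); the intervals are any `[lo_i, hi_i)` with `log(hi_i/lo_i) ≤ Λ` (`ϱ = e^Λ` need
not be common); `Δ ≥ 3`; `Y > 0` arbitrary; and we ask `Λ ≤ log Δ` (i.e. `ϱ ≤ Δ`), which the printed
statement leaves implicit — the `m = 1` error `Y exp(−c√(log Δ))` feeds the window sums
`∑ log N(P)/N(P) = log ϱ (1 + O(exp(−c√(log Δ)))) + O(1)`, and `log ϱ · exp(−c√(log Δ)) = O(1)` needs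
`log ϱ ≪ exp(c√(log Δ))`; in the application `ϱ = X^ξ ≤ X^τ = Δ` ("we may take `ϱ = X^ξ` and `Δ = L`",
p. 64). Conclusion: `|∑ − meas(J(Y,m))| ≤ C m Y (c₁ + Λ)^{m−1} exp(−c₂√(log Δ))` with absolute
`c₁ ≥ 0`, `c₂ > 0`, `C ≥ 0` (from the de la Vallée-Poussin constants of
`Literature.NumberTheory.LFunctions.NumberField.abs_degreeOneTheta_sub_self_le`, PROVED in the tree).
[cite: HeathBrownActa2001, Lemma 4.10] -/
theorem HeathBrown2001_lemma_4_10 :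
    ∃ c₁ c₂ C : ℝ, 0 ≤ c₁ ∧ 0 < c₂ ∧ 0 ≤ C ∧
      ∀ (j : ℕ) (lo hi : Fin (j + 1) → ℝ) (F : Fin (j + 1) → Finset (Ideal (𝓞 K))),
        (∀ i P, P ∈ F i ↔ P.IsPrime ∧ P ≠ ⊥ ∧ lo i ≤ (Ideal.absNorm P : ℝ) ∧
          (Ideal.absNorm P : ℝ) < hi i ∧ (Ideal.absNorm P).Prime) →
        ∀ Δ : ℝ, 3 ≤ Δ → (∀ i, Δ ≤ lo i) → (∀ i, lo i ≤ hi i) →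
        ∀ Λ : ℝ, 0 ≤ Λ → Λ ≤ Real.log Δ → (∀ i, Real.log (hi i / lo i) ≤ Λ) →
        ∀ Y : ℝ, 0 < Y →
          |(∑ P ∈ Fintype.piFinset F,
              if ∏ i, (Ideal.absNorm (P i) : ℝ) ≤ Y then ∏ i, Real.log (Ideal.absNorm (P i)) else 0) -
            (volume {x : Fin (j + 1) → ℝ | (∀ i, x i ∈ Ico (lo i) (hi i)) ∧ ∏ i, x i ≤ Y}).toReal| ≤
          C * ((j : ℝ) + 1) * Y * (c₁ + Λ) ^ j * Real.exp (-c₂ * Real.sqrt (Real.log Δ)) := by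
  obtain ⟨c, hc, C₀, hθ⟩ := abs_degreeOneTheta_sub_self_le K
  -- the constant `C₀` is necessarily nonnegative, and `c` may be decreased to `min c 1`
  have hC₀ : 0 ≤ C₀ := by
    have h := (abs_nonneg _).trans (hθ 2 le_rfl)
    have hpos : (0 : ℝ) < 2 * Real.exp (-c * Real.sqrt (Real.log 2)) := by positivity
    by_contra hneg
    have : C₀ * 2 * Real.exp (-c * Real.sqrt (Real.log 2)) < 0 := by
      rw [mul_assoc]; exact mul_neg_of_neg_of_pos (lt_of_not_ge hneg) hpos
    linarith
  set c' : ℝ := min c 1 with hc'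
  have hc'0 : 0 < c' := lt_min hc one_pos
  have hc'1 : c' ≤ 1 := min_le_right _ _
  have hθ' : ∀ x : ℝ, 2 ≤ x → |degreeOneTheta K x - x| ≤ C₀ * x * Real.exp (-c' * Real.sqrt (Real.log x)) := by
    intro x hx
    refine (hθ x hx).trans ?_
    have hx0 : 0 ≤ x := by linarith
    refine mul_le_mul_of_nonneg_left (Real.exp_le_exp.mpr ?_) (mul_nonneg hC₀ hx0)
    have : c' ≤ c := min_le_left _ _
    nlinarith [Real.sqrt_nonneg (Real.log x)]
  refine ⟨8 + 2 * C₀ + 4 * C₀ / c' ^ 2, c', 2 * C₀ + 32, by positivity, hc'0, by positivity, ?_⟩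
  exact lemma_4_10_aux hθ' hc'0 hc'1 hC₀

end Induction

/-! ### Specialisation to Heath-Brown's boxes `∏ J(m_i)` -/

section HB

variable {X τ : ℝ}

/-- **Lemma 4.10 for the boxes `∏ J(m_i)` of §3** ("Since `J(m_i) = [X^{m_iξ}, X^{(1+m_i)ξ})` with
`X^{m_iξ} ≥ X^τ ≥ L`, we may take `ϱ = X^ξ` and `Δ = L`", p. 64 — here with the larger `Δ = X^τ`): for
`𝐦` of length `n + 1` satisfying (3.5)–(3.7), `1 < X`, `0 < τ ≤ 1`, `X^τ ≥ 3` and `Y > 0`, the sum over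
tuples of first-degree primes `P_i ∈ 𝒥(m_i)` with `∏ N(P_i) ≤ Y` of `∏ log N(P_i)` differs from
`w(Y, 𝐦)` (`wMeas`, (3.12)) by at most `C (n+1) Y (c₁ + ξ log X)^n exp(−c₂√(τ log X))`; this is the
input of the evaluation of `U(ℬ)` on p. 64. [cite: HeathBrownActa2001, Lemma 4.10] -/
theorem primeTuples_sub_wMeas_le :
    ∃ c₁ c₂ C : ℝ, 0 ≤ c₁ ∧ 0 < c₂ ∧ 0 ≤ C ∧
      ∀ (X τ : ℝ), 1 < X → 0 < τ → τ ≤ 1 → 3 ≤ X ^ τ →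
      ∀ (n : ℕ) (m : Fin (n + 1) → ℕ), CoreAdmissible τ m → ∀ Y : ℝ, 0 < Y →
        |(∑ P ∈ Fintype.piFinset fun i => Jprimes X τ (m i),
            if ∏ i, (Ideal.absNorm (P i) : ℝ) ≤ Y then ∏ i, Real.log (Ideal.absNorm (P i)) else 0) -
          wMeas X τ m Y| ≤
        C * ((n : ℝ) + 1) * Y * (c₁ + hbXi τ * Real.log X) ^ n *
          Real.exp (-c₂ * Real.sqrt (τ * Real.log X)) := by
  obtain ⟨c₁, c₂, C, hc₁, hc₂, hC, h⟩ := HeathBrown2001_lemma_4_10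
  refine ⟨c₁, c₂, C, hc₁, hc₂, hC, fun X τ hX hτ hτ1 h3 n m hm Y hY => ?_⟩
  have hX0 : 0 < X := by linarith
  have hξ := hbXi_pos hτ
  have hξτ : hbXi τ ≤ τ := hbXi_le hτ.le hτ1
  have hlo : ∀ i, X ^ τ ≤ X ^ ((m i : ℝ) * hbXi τ) := fun i => by
    refine Real.rpow_le_rpow_of_exponent_le hX.le ?_
    have := hm.2.1 i
    rwa [div_le_iff₀ hξ] at this
  have hlohi : ∀ i : Fin (n + 1), X ^ ((m i : ℝ) * hbXi τ) ≤ X ^ (((m i : ℝ) + 1) * hbXi τ) := fun i =>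
    Real.rpow_le_rpow_of_exponent_le hX.le (by nlinarith)
  have hΛ : ∀ i : Fin (n + 1), Real.log (X ^ (((m i : ℝ) + 1) * hbXi τ) / X ^ ((m i : ℝ) * hbXi τ)) ≤
      hbXi τ * Real.log X := fun i => (log_hbBox_ratio hX0 τ (m i)).le
  have hlogΔ : Real.log (X ^ τ) = τ * Real.log X := Real.log_rpow hX0 τ
  have hΛΔ : hbXi τ * Real.log X ≤ Real.log (X ^ τ) := by
    rw [hlogΔ]; exact mul_le_mul_of_nonneg_right hξτ (Real.log_nonneg hX.le)
  have key := h n (fun i => X ^ ((m i : ℝ) * hbXi τ)) (fun i => X ^ (((m i : ℝ) + 1) * hbXi τ))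
    (fun i => Jprimes X τ (m i)) (fun i P => mem_Jprimes_iff X τ) (X ^ τ) h3 hlo hlohi
    (hbXi τ * Real.log X) (mul_nonneg hξ.le (Real.log_nonneg hX.le)) hΛΔ hΛ Y hY
  rw [hlogΔ] at key
  exact key

end HB


end Literature.NumberTheory.Sieve.CubicSieve

end
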